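import Literature.AnabelianGeometry.SemiGraphs.PSCThm16iiiAssemblyProofs
import Literature.AnabelianGeometry.SemiGraphs.PSCVertexQuotientPrimeProofs
import Literature.AnabelianGeometry.SemiGraphs.PSCVertexQuotientConversePrimeProofs
import Literature.AnabelianGeometry.SemiGraphs.PSCVertexSetCharacterizationHoldsProofs
import HarnessLib

/-!
# [CombGC] Theorem 1.6 (iii), assembled over the CORRECTED [IUTchI] Rmk. 1.2.3 (iv) input `UnrVerticialCharacterizationHolds'`

Mochizuki, *A combinatorial version of the Grothendieck conjecture*, Tohoku Math. J. **59** (2007)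
[CombGC], Theorem 1.6 (iii), author's manuscript p. 13 ("Assume that `G`, `H` are sturdy. Then `β` is
verticially filtration-preserving if and only if it is group-theoretically verticial"), with the amended
proof [IUTchI] Remark 1.2.3 (vii), kurims p. 43 ("necessity follows formally from the characterization of
unramified verticial subgroups given in Remark 1.4.3 [= Rmk. 1.2.3 (iv)] and the characterization of
verticially purely totally ramified … coverings given in Remark 1.4.2").

SUCCESSOR MIGRATION (abc-iut cell, finding F-L3t4g5-1).  The writer's assembly
`PSCThm16iiiAssemblyProofs.lean` (abc-iut-w4-d052, row T16-L00 (iii) of `plan/L3/SUBDAG-CombGC-Thm16.md`)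
feeds abc-iut-w5-d174's bodies closer `unrVerticiallyFiltrationPreservingIffVerticial_of_bodies` with the
three bodies (VQ)/(VS)/(EX) of [IUTchI] Rmk. 1.2.3 (iv) at every `Π^unr`-covering datum, derived from the
FROZEN split injection `UnrVerticialSplitInjection` — i.e. from FACT row F-1938
`UnrVerticialCharacterizationHolds Ω`, which abc-iut-L3-t4 REFUTED as typed (it is false at every
one-vertex datum on a nonabelian group, `PSCUnrVerticialOneVertex.lean`; every covering level of a
smooth curve has one vertex).  This proof-only file re-assembles Theorem 1.6 (iii) over the SUCCESSOR
`UnrVerticialSplitInjection'` / `UnrVerticialCharacterizationHolds'` (`PSCRamificationSplitInjection.lean`),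
which HOLDS at the smooth-proper origin (`unrVerticialCharacterizationHolds'_of_smoothProper`): the
bodies are now `vertexQuotientCharacterization_of_inputs'` (this file; forward half d052's
`vertexQuotientCharacterization_mp`, converse `vertexQuotientCharacterization_mpr'`),
`vertexSetCharacterization_of_inputs'` and `exists_isElemAbUnrQuotient_inf_eq_vertexQuotientKer'`
(`PSCVertexQuotientPrimeProofs.lean`), valid at EVERY level, one-vertex levels included:

* `bodyVQ_restrict'`, `bodyVS_restrict'`, `bodyEX_restrict'` — the three bodies at the covering datum
  `G.restrictBD U hU bd` from `UnrVerticialSplitInjection'` there;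
* `unrVerticiallyFiltrationPreservingIffVerticial_of_inputs'` — Thm. 1.6 (iii) for every `β` from the
  per-level inputs, the split injection in its corrected form;
* `unrVerticialIff_holds_of_inputs'` — the typed statement for all data of `Ω`-type on profinite
  groups, every input an origin statement BY NAME, with `UnrVerticialCharacterizationHolds' Ω` in place
  of F-1938;
* `vertexSetCharacterizationHolds_of_profiniteOrigin'` — [IUTchI] Rmk. 1.2.3 (iv)'s conclusion
  `VertexSetCharacterizationHolds Ω` from the corrected inputs (successor of abc-iut-w4-d052's
  `vertexSetCharacterizationHolds_of_profiniteOrigin`).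

Proof-only (0 defs); a FACT row is an assumption label; nothing here takes a side on [IUTchIII]
Cor. 3.12. [cite: MochizukiCombGC2007, Thm 1.6(iii) p.13] [cite: Mochizuki2012, IUTchI Rmk 1.2.3(vii) p.43]
[cite: Mochizuki2012, IUTchI Rmk 1.2.3(iv) p.42]
-/

noncomputable section

namespace Literature.AnabelianGeometry.SemiGraphs

namespace PSCDatum

universe u

variable {P : Type u} [Group P] [TopologicalSpace P] [IsTopologicalGroup P] [CompactSpace P]
  [TotallyDisconnectedSpace P]
variable {P' : Type u} [Group P'] [TopologicalSpace P'] [IsTopologicalGroup P'] [CompactSpace P']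
  [TotallyDisconnectedSpace P']

/-! ### Body (VQ), both halves, over the corrected split injection -/

/-- **Row T16-L13: `PSCDatum.VertexQuotientCharacterization` from its CORRECTED inputs** — both halves of
[IUTchI] Rmk. 1.2.3 (iv)'s displayed characterization, for sturdy data on a profinite group: forward by
abc-iut-w4-d052's `vertexQuotientCharacterization_mp` (criterion + "[nontrivial!]", the latter now from the
corrected independence clause, `vertexQuotientKer_ne_unrVertAb'`), converse by
`vertexQuotientCharacterization_mpr'` (criterion + complement clause of `UnrVerticialSplitInjection'`).
[cite: Mochizuki2012, IUTchI Rmk 1.2.3(iv) p.42] -/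
theorem vertexQuotientCharacterization_of_inputs' (G : PSCDatum P)
    (hiff : G.ElementaryQuotientVerticiallyRamifiedIff) (hsplit : G.UnrVerticialSplitInjection')
    (hrank : G.UnrVertAbOfRank) : G.VertexQuotientCharacterization := by
  intro hGs l hS H' hH'
  have hlS : l ∈ G.Sigma := by rw [hS]; exact Set.mem_singleton l
  have hK : ∀ v : G.graph.V, G.vertexQuotientKer l v ≠ G.unrVertAb := fun v =>
    G.vertexQuotientKer_ne_unrVertAb' hsplit hrank hGs hlS v
  constructor
  · exact fun h => G.vertexQuotientCharacterization_mp hiff hGs hS hK hH' h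
  · rintro ⟨hram, hmax⟩
    exact G.vertexQuotientCharacterization_mpr' hiff hsplit hGs hS hH' hram hmax

/-! ### The three bodies at a covering datum, from the corrected split injection there -/

section Bodies

variable (G : PSCDatum P) (bd : G.BranchData)

/-- (VQ) at every `Π^unr`-level over `UnrVerticialSplitInjection'` of the covering datum `G_U` (both
halves, row T16-L13), read without its "sturdy"/"`Σ = {l}`" guards.
[cite: Mochizuki2012, IUTchI Rmk 1.2.3(iv) p.42] -/
theorem bodyVQ_restrict' {l : ℕ} (hSG : G.Sigma = {l}) (hGs : G.IsSturdy)
    (hiff : ∀ (U : Subgroup P) [U.FiniteIndex] (hU : IsOpen (U : Set P)), G.unrKer ≤ U →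
      (G.restrictBD U hU bd).ElementaryQuotientVerticiallyRamifiedIff)
    (hsplit : ∀ (U : Subgroup P) [U.FiniteIndex] (hU : IsOpen (U : Set P)), G.unrKer ≤ U →
      (G.restrictBD U hU bd).UnrVerticialSplitInjection')
    (hrank : ∀ (U : Subgroup P) [U.FiniteIndex] (hU : IsOpen (U : Set P)), G.unrKer ≤ U →
      (G.restrictBD U hU bd).UnrVertAbOfRank)
    (U : Subgroup P) [U.FiniteIndex] (hU : IsOpen (U : Set P)) (hK : G.unrKer ≤ U)
    (H₁ : Subgroup U) (hH₁ : (G.restrict U hU).IsElemAbUnrQuotient l H₁) :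
    (∃ w : (G.restrictGraph U).V, (G.restrict U hU).unrVertAb ⊔ H₁ = ⊤ ∧
        (G.restrict U hU).unrVertAb ⊓ H₁ = (G.restrict U hU).vertexQuotientKer l w) ↔
      ((G.restrict U hU).IsVerticiallyPurelyTotallyRamified ⊤ H₁ ∧ ∀ H₂ : Subgroup U,
        (G.restrict U hU).IsElemAbUnrQuotient l H₂ →
        (G.restrict U hU).IsVerticiallyPurelyTotallyRamified ⊤ H₂ → H₂ ≤ H₁ → H₂ = H₁) := by
  haveI : CompactSpace U :=
    isCompact_iff_compactSpace.mp (Subgroup.isClosed_of_isOpen U hU).isCompact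
  exact (G.restrictBD U hU bd).vertexQuotientCharacterization_of_inputs' (hiff U hU hK) (hsplit U hU hK)
    (hrank U hU hK) (hGs.restrictBD G U hU bd) l hSG H₁ hH₁

/-- (VS) at every `Π^unr`-level over `UnrVerticialSplitInjection'` of the covering datum: "[nontrivial!]
quotients" — `w ↦ Ker_w` injective and no `Ker_w` is everything (row T16-L13).
[cite: Mochizuki2012, IUTchI Rmk 1.2.3(iv) p.42] -/
theorem bodyVS_restrict' {l : ℕ} (hSG : G.Sigma = {l}) (hGs : G.IsSturdy)
    (hsplit : ∀ (U : Subgroup P) [U.FiniteIndex] (hU : IsOpen (U : Set P)), G.unrKer ≤ U →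
      (G.restrictBD U hU bd).UnrVerticialSplitInjection')
    (hrank : ∀ (U : Subgroup P) [U.FiniteIndex] (hU : IsOpen (U : Set P)), G.unrKer ≤ U →
      (G.restrictBD U hU bd).UnrVertAbOfRank)
    (U : Subgroup P) [U.FiniteIndex] (hU : IsOpen (U : Set P)) (hK : G.unrKer ≤ U) :
    Function.Injective ((G.restrict U hU).vertexQuotientKer l) ∧
      ∀ w : (G.restrictGraph U).V,
        (G.restrict U hU).vertexQuotientKer l w ≠ (G.restrict U hU).unrVertAb := by
  haveI : CompactSpace U :=
    isCompact_iff_compactSpace.mp (Subgroup.isClosed_of_isOpen U hU).isCompact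
  exact (G.restrictBD U hU bd).vertexSetCharacterization_of_inputs' (hsplit U hU hK) (hrank U hU hK)
    (hGs.restrictBD G U hU bd) l hSG

/-- (EX) at every `Π^unr`-level over `UnrVerticialSplitInjection'` of the covering datum: the quotient
`M^unr-vert ↠ M^unr[w] ⊗ F_l` IS the restriction of an elementary abelian quotient of `M^unr`
(abc-iut-w5-d174's existence theorem, corrected form, at the covering datum).
[cite: Mochizuki2012, IUTchI Rmk 1.2.3(iv) p.42] -/
theorem bodyEX_restrict' {l : ℕ} (hSG : G.Sigma = {l}) (hGs : G.IsSturdy)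
    (hsplit : ∀ (U : Subgroup P) [U.FiniteIndex] (hU : IsOpen (U : Set P)), G.unrKer ≤ U →
      (G.restrictBD U hU bd).UnrVerticialSplitInjection')
    (hrank : ∀ (U : Subgroup P) [U.FiniteIndex] (hU : IsOpen (U : Set P)), G.unrKer ≤ U →
      (G.restrictBD U hU bd).UnrVertAbOfRank)
    (U : Subgroup P) [U.FiniteIndex] (hU : IsOpen (U : Set P)) (hK : G.unrKer ≤ U)
    (w : (G.restrictGraph U).V) :
    ∃ H₁ : Subgroup U, (G.restrict U hU).IsElemAbUnrQuotient l H₁ ∧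
      (G.restrict U hU).unrVertAb ⊔ H₁ = ⊤ ∧
      (G.restrict U hU).unrVertAb ⊓ H₁ = (G.restrict U hU).vertexQuotientKer l w := by
  haveI : CompactSpace U :=
    isCompact_iff_compactSpace.mp (Subgroup.isClosed_of_isOpen U hU).isCompact
  have hlS : l ∈ (G.restrictBD U hU bd).Sigma := by
    change l ∈ G.Sigma
    rw [hSG]; exact Set.mem_singleton l
  exact (G.restrictBD U hU bd).exists_isElemAbUnrQuotient_inf_eq_vertexQuotientKer' (hsplit U hU hK)
    (hrank U hU hK) (hGs.restrictBD G U hU bd) (G.sigma_prime l (by rw [hSG]; exact Set.mem_singleton l))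
    hlS w

end Bodies

/-! ### Theorem 1.6 (iii), from its corrected inputs -/

/-- **[CombGC] Theorem 1.6 (iii) from its inputs, the split injection in its CORRECTED form** (with
[IUTchI] Rmk. 1.2.3 (vii)): for sturdy `G`, `H` of pro-`Σ` PSC-type on profinite groups, `Σ = {l}`, and
ANY `β : Π^unr_G ⥲ Π^unr_H`: `β` is verticially filtration-preserving iff it is group-theoretically
verticial — granted, BY NAME, Rmk. 1.1.3 (`AbelianizedGrphRank`) and connectedness
(`VertCountLeNodeCountSucc`) for `G`, `H`, and at every `Π^unr`-covering datum `G.restrictBD U hU bd` /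
`H.restrictBD U₁ hU₁ bd'` the inputs of [IUTchI] Rmk. 1.2.3 (iv) (`ElementaryQuotientVerticiallyRamifiedIff`,
`UnrVerticialSplitInjection'`) and Rmk. 1.1.5 (`UnrVertAbOfRank`).  Composition: abc-iut-w5-d174's bodies
closer ∘ the corrected bodies. [cite: MochizukiCombGC2007, Thm 1.6(iii) p.13] -/
theorem unrVerticiallyFiltrationPreservingIffVerticial_of_inputs' (G : PSCDatum P) (H : PSCDatum P')
    (β : (P ⧸ G.unrKer) ≃ₜ* (P' ⧸ H.unrKer)) (bd : G.BranchData) (bd' : H.BranchData)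
    {l : ℕ} (hSG : G.Sigma = {l}) (hSH : H.Sigma = {l})
    (hrkG : G.AbelianizedGrphRank) (hrkH : H.AbelianizedGrphRank)
    (hiG : G.VertCountLeNodeCountSucc) (hiH : H.VertCountLeNodeCountSucc)
    (hiffG : ∀ (U : Subgroup P) [U.FiniteIndex] (hU : IsOpen (U : Set P)), G.unrKer ≤ U →
      (G.restrictBD U hU bd).ElementaryQuotientVerticiallyRamifiedIff)
    (hsplitG : ∀ (U : Subgroup P) [U.FiniteIndex] (hU : IsOpen (U : Set P)), G.unrKer ≤ U →
      (G.restrictBD U hU bd).UnrVerticialSplitInjection')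
    (hrankG : ∀ (U : Subgroup P) [U.FiniteIndex] (hU : IsOpen (U : Set P)), G.unrKer ≤ U →
      (G.restrictBD U hU bd).UnrVertAbOfRank)
    (hiffH : ∀ (U₁ : Subgroup P') [U₁.FiniteIndex] (hU₁ : IsOpen (U₁ : Set P')), H.unrKer ≤ U₁ →
      (H.restrictBD U₁ hU₁ bd').ElementaryQuotientVerticiallyRamifiedIff)
    (hsplitH : ∀ (U₁ : Subgroup P') [U₁.FiniteIndex] (hU₁ : IsOpen (U₁ : Set P')), H.unrKer ≤ U₁ →
      (H.restrictBD U₁ hU₁ bd').UnrVerticialSplitInjection')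
    (hrankH : ∀ (U₁ : Subgroup P') [U₁.FiniteIndex] (hU₁ : IsOpen (U₁ : Set P')), H.unrKer ≤ U₁ →
      (H.restrictBD U₁ hU₁ bd').UnrVertAbOfRank) :
    G.UnrVerticiallyFiltrationPreservingIffVerticial H β := by
  intro hGs hHs
  exact G.unrVerticiallyFiltrationPreservingIffVerticial_of_bodies H β hSG hSH hrkG hrkH hiG hiH
    (fun U _ hU hK H₁ hH₁ => G.bodyVQ_restrict' bd hSG hGs hiffG hsplitG hrankG U hU hK H₁ hH₁)
    (fun U _ hU hK => G.bodyVS_restrict' bd hSG hGs hsplitG hrankG U hU hK)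
    (fun U _ hU hK w => G.bodyEX_restrict' bd hSG hGs hsplitG hrankG U hU hK w)
    (fun U₁ _ hU₁ hK H₁ hH₁ => H.bodyVQ_restrict' bd' hSH hHs hiffH hsplitH hrankH U₁ hU₁ hK H₁ hH₁)
    (fun U₁ _ hU₁ hK => H.bodyVS_restrict' bd' hSH hHs hsplitH hrankH U₁ hU₁ hK)
    (fun U₁ _ hU₁ hK w => H.bodyEX_restrict' bd' hSH hHs hsplitH hrankH U₁ hU₁ hK w) hGs hHs

omit [CompactSpace P] [TotallyDisconnectedSpace P] in
/-- **The frozen per-level inputs imply the corrected ones** (bridge for consumers still holding the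
frozen split injection at every level: `UnrVerticialSplitInjection.toPrime`), so that Thm. 1.6 (iii)
from the frozen inputs is a special case of the corrected assembly.
[cite: MochizukiCombGC2007, Thm 1.6(iii) p.13] -/
theorem splitInjection'_levels_of_old (G : PSCDatum P) (bd : G.BranchData)
    (hsplitG : ∀ (U : Subgroup P) [U.FiniteIndex] (hU : IsOpen (U : Set P)), G.unrKer ≤ U →
      (G.restrictBD U hU bd).UnrVerticialSplitInjection) :
    ∀ (U : Subgroup P) [U.FiniteIndex] (hU : IsOpen (U : Set P)), G.unrKer ≤ U →
      (G.restrictBD U hU bd).UnrVerticialSplitInjection' :=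
  fun U _ hU hK => UnrVerticialSplitInjection.toPrime _ (hsplitG U hU hK)

/-! ### Over an origin predicate with profinite data -/

section Origin

variable (Ω : PSCOrigin.{u})

/-- **[CombGC] Theorem 1.6 (iii) as typed (`UnrVerticiallyFiltrationPreservingIffVerticial`), for all
data of `Ω`-type on profinite groups with `Σ_G = Σ_H = {l}` and every `β`, over the CORRECTED [IUTchI]
Rmk. 1.2.3 (iv) input** — every input an origin statement BY NAME: Rmk. 1.1.3 (`RankStatementsHold Ω`),
connectedness of the coverings (`VertCountLeNodeCountSuccHolds Ω`), [IUTchI] Rmk. 1.2.3 (iv) in its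
corrected successor form (`UnrVerticialCharacterizationHolds' Ω`, abc-iut-L3-t4; holds at the smooth-proper
origin), Rmk. 1.1.5 (`UnrVertAbOfRankHolds Ω`), and "coverings of PSC-type data are of PSC-type"
(`RestrictBDOfPSCTypeHolds Ω`); profiniteness displayed as `hprof`.
[cite: MochizukiCombGC2007, Thm 1.6(iii) p.13] -/
theorem unrVerticialIff_holds_of_inputs'
    (hprof : ∀ ⦃Q : Type u⦄ [Group Q] [TopologicalSpace Q] [IsTopologicalGroup Q] (K : PSCDatum Q),
      Ω.IsOfPSCType K → CompactSpace Q ∧ TotallyDisconnectedSpace Q)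
    (hrank : RankStatementsHold Ω) (hconn : VertCountLeNodeCountSuccHolds Ω)
    (hunr : UnrVerticialCharacterizationHolds' Ω) (hrankv : UnrVertAbOfRankHolds Ω)
    (hres : RestrictBDOfPSCTypeHolds Ω)
    ⦃Q : Type u⦄ [Group Q] [TopologicalSpace Q] [IsTopologicalGroup Q]
    ⦃Q' : Type u⦄ [Group Q'] [TopologicalSpace Q'] [IsTopologicalGroup Q']
    {G : PSCDatum Q} {H : PSCDatum Q'} (hGΩ : Ω.IsOfPSCType G) (hHΩ : Ω.IsOfPSCType H)
    {l : ℕ} (hSG : G.Sigma = {l}) (hSH : H.Sigma = {l}) (β : (Q ⧸ G.unrKer) ≃ₜ* (Q' ⧸ H.unrKer)) :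
    G.UnrVerticiallyFiltrationPreservingIffVerticial H β := by
  obtain ⟨hcQ, htQ⟩ := hprof G hGΩ
  obtain ⟨hcQ', htQ'⟩ := hprof H hHΩ
  haveI := hcQ; haveI := htQ; haveI := hcQ'; haveI := htQ'
  obtain ⟨bd, hbd⟩ := hres G hGΩ
  obtain ⟨bd', hbd'⟩ := hres H hHΩ
  exact G.unrVerticiallyFiltrationPreservingIffVerticial_of_inputs' H β bd bd' hSG hSH (hrank G hGΩ).1
    (hrank H hHΩ).1 (hconn G hGΩ) (hconn H hHΩ)
    (fun U _ hU _ => (hunr _ (hbd U hU)).2) (fun U _ hU _ => (hunr _ (hbd U hU)).1)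
    (fun U _ hU _ => hrankv _ (hbd U hU))
    (fun U₁ _ hU₁ _ => (hunr _ (hbd' U₁ hU₁)).2) (fun U₁ _ hU₁ _ => (hunr _ (hbd' U₁ hU₁)).1)
    (fun U₁ _ hU₁ _ => hrankv _ (hbd' U₁ hU₁))

/-- **[IUTchI] Remark 1.2.3 (iv), verticial part, as printed — for profinite origin predicates, over the
CORRECTED split injection**: `UnrVerticialCharacterizationHolds' Ω` together with the rank `2·genus(v)` of
`M^unr_G[v]` (`UnrVertAbOfRankHolds Ω`) give `VertexSetCharacterizationHolds Ω` (successor of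
abc-iut-w4-d052's `vertexSetCharacterizationHolds_of_profiniteOrigin`, whose F-1938 input is refuted as
typed). [cite: Mochizuki2012, IUTchI Rmk 1.2.3(iv) p.42] -/
theorem vertexSetCharacterizationHolds_of_profiniteOrigin'
    (hΩ : ∀ ⦃Q : Type u⦄ [Group Q] [TopologicalSpace Q] (G : PSCDatum Q),
      Ω.IsOfPSCType G → CompactSpace Q ∧ T2Space Q ∧ TotallyDisconnectedSpace Q)
    (h₁ : UnrVerticialCharacterizationHolds' Ω) (h₂ : UnrVertAbOfRankHolds Ω) :
    VertexSetCharacterizationHolds Ω := by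
  intro Q _ _ _ G hG
  obtain ⟨hc, ht, hd⟩ := hΩ G hG
  haveI := hc; haveI := ht; haveI := hd
  exact ⟨G.vertexQuotientCharacterization_of_inputs' (h₁ G hG).2 (h₁ G hG).1 (h₂ G hG),
    G.vertexSetCharacterization_of_inputs' (h₁ G hG).1 (h₂ G hG)⟩

/-- The same with the profiniteness hypothesis "compact and totally disconnected" (Hausdorff follows
for a topological group). [cite: Mochizuki2012, IUTchI Rmk 1.2.3(iv) p.42] -/
theorem vertexSetCharacterizationHolds_of_compact_totallyDisconnected'
    (hΩ : ∀ ⦃Q : Type u⦄ [Group Q] [TopologicalSpace Q] [IsTopologicalGroup Q] (G : PSCDatum Q),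
      Ω.IsOfPSCType G → CompactSpace Q ∧ TotallyDisconnectedSpace Q)
    (h₁ : UnrVerticialCharacterizationHolds' Ω) (h₂ : UnrVertAbOfRankHolds Ω) :
    VertexSetCharacterizationHolds Ω := by
  intro Q _ _ _ G hG
  obtain ⟨hc, hd⟩ := hΩ G hG
  haveI := hc; haveI := hd
  haveI : T2Space Q := inferInstance
  exact ⟨G.vertexQuotientCharacterization_of_inputs' (h₁ G hG).2 (h₁ G hG).1 (h₂ G hG),
    G.vertexSetCharacterization_of_inputs' (h₁ G hG).1 (h₂ G hG)⟩

/-- **At the smooth-proper origin both conclusions are now UNCONDITIONAL in the Rmk.-1.2.3-(iv) slot**: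
for an origin all of whose data are of smooth-proper shape (one vertex, no edges, `Π_v = Π`) on profinite
groups, `VertexSetCharacterizationHolds Ω` follows from the rank statement `UnrVertAbOfRankHolds Ω`
alone, the corrected split injection being a THEOREM there (abc-iut-L3-t4's
`unrVerticialCharacterizationHolds'_of_smoothProper`). [cite: Mochizuki2012, IUTchI Rmk 1.2.3(iv) p.42] -/
theorem vertexSetCharacterizationHolds_of_smoothProper
    (hprof : ∀ ⦃Q : Type u⦄ [Group Q] [TopologicalSpace Q] [IsTopologicalGroup Q] (G : PSCDatum Q),
      Ω.IsOfPSCType G → CompactSpace Q ∧ TotallyDisconnectedSpace Q)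
    (hΩ : ∀ ⦃Q : Type u⦄ [Group Q] [TopologicalSpace Q] (G : PSCDatum Q), Ω.IsOfPSCType G →
      IsEmpty G.graph.N ∧ IsEmpty G.graph.C ∧ (∀ v, G.vertGp v = ⊤) ∧ ∃ v₀ : G.graph.V, ∀ w, w = v₀)
    (h₂ : UnrVertAbOfRankHolds Ω) : VertexSetCharacterizationHolds Ω :=
  vertexSetCharacterizationHolds_of_compact_totallyDisconnected' Ω hprof
    (unrVerticialCharacterizationHolds'_of_smoothProper Ω hΩ) h₂

end Origin

end PSCDatum

end Literature.AnabelianGeometry.SemiGraphs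

end

-- build-queue re-enqueue (comment-only re-land by abc-iut-w4-d014 g7, 2026-08-26T10:4xZ): declarations byte-identical to the
-- accepted tree copy (sha16 7054c8e9f4f85ffe); purpose: produce the missing olean (stranded accept) so that PENDING children deferred «no-olean» can verify.
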